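import Summits.HodgeConjecture.HodgeConjecture.Theorems.Ring2WeilCoverageCMFieldAllPrimesB
import Summits.HodgeConjecture.HodgeConjecture.Theorems.Ring2WeilCoverageCMFieldAllPrimesG
import Mathlib.NumberTheory.LSeries.PrimesInAP
import HarnessLib

/-!
# Weil-type components over quartic CM fields, IX (part D): the prime classes are PAIRWISE DISTINCT — INFINITELY
# MANY non-split components for each of the seven census fields (Dirichlet)

research route conditional on HC_CM; not a corollary; Q11.4-sentence-2 already refuted in dim ≥ 3. Cell
`pub-hodge-ring2`, seat `ring2-b03` (gen 51); conclusion of part IX (`Ring2WeilCoverageCMFieldAllPrimes`, `…B`, `…C`, `…G`).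
For each of the seven quartic CM fields `E = F(√σ)` of the Weil-type family-coverage census
`HOME/WEIL-FAMILY-COVERAGE.md` §b03 (Deligne's carriers `R = S² + pS + q`; components `W8.E.δ`,
`δ ∈ F^×/Nm_{E/F}(E^×) = cmNormResidueGroup R`) parts A–C give a set of primes `P_E`, described by congruences, with
`[ℓw] ≠ [1]` for all `ℓ ∈ P_E`, `ℓ ∤ w`. §0 turns any such family into

* PAIRWISE DISTINCTNESS: `[ℓ₁] = [ℓ₂] ⇒ ℓ₁ = ℓ₂` for `ℓ₁, ℓ₂ ∈ P_E` (apply the criterion at `ℓ₁` to `w = ℓ₂` and use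
  that every class has order `2`: `[ℓ₁ℓ₂] ≠ [1] ⇒ [ℓ₁] ≠ [ℓ₂]`, part VIII `mk_ne_mk_of_mk_mul_ne_split`);
* INFINITUDE: if `P_E` is infinite, the non-split classes `{[ℓ] : ℓ ∈ P_E}` form an infinite set of pairwise distinct
  NON-SPLIT Weil-type components — and `P_E` is infinite by DIRICHLET'S THEOREM (Mathlib
  `Nat.infinite_setOf_prime_and_modEq`).

§1–§7 instantiate: `ℚ(ζ₅)` (`ℓ ≢ 0, 1 (mod 5)`, `ℓ ≠ 2`), `ℚ(ζ₈)` (`ℓ ≡ 7 (mod 8)`), `ℚ(ζ₁₂)` (`ℓ ≡ 11 (mod 12)`),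
`ℚ(√-3,√5)` (`ℓ ≡ 11, 14 (mod 15)`), `ℚ(i,√5)` (`ℓ ≡ 11, 19 (mod 20)`), `ℚ(√-(2+√2))` (`ℓ ≢ ±1 (mod 16)`,
`ℓ ≠ 2`), `ℚ(√-(3+√2))` (`ℓ mod 56 ∈ {5, 11, 13, 43, 45, 51}`): for EVERY census field the index set of the
`(E, 4)`-Weil locus at `g = 8` contains infinitely many pairwise distinct non-split components `W8.E.[ℓ]`, in the
kernel — the census's «countably many rows per `E`» (cited there from the Hasse norm theorem / O'Meara 71:19) now has
a hypothesis-free lower bound. No named fact, no definition, no `sorry`; nothing about the Hodge conjecture is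
asserted (the general member of every such component is OPEN, census §b03.2; each carries a CM point with HC, §b03.6).
References: [Deligne1982HodgeCycles] §4 p. 30 (1), Cor. 4.2, Lemma 4.6; [Landherr1936HermitianForms]. -/

noncomputable section

set_option linter.dupNamespace false

open Polynomial

namespace Summit.HodgeConjecture.HodgeConjecture.Ring2.WeilCoverageCM

open Literature.AlgebraicGeometry.Deligne1982
open Literature.AlgebraicGeometry.HodgeTheory (splitDiscriminantClassCM)

/-! ### §0 Generic: a prime family with the criterion gives pairwise distinct classes, infinitely many if infinite -/

section Generic

variable {R : Polynomial ℤ} [Fact (Irreducible (realPolyQ R))] [Fact (Irreducible (cmPolyQ R))]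

/-- **Pairwise distinctness from a criterion on a prime family.** If `[ℓw] ≠ [1]` for every prime `ℓ ∈ P` and every
`ℓ ∤ w`, then for primes `ℓ₁ ≠ ℓ₂` in `P` the classes `[ℓ₁]`, `[ℓ₂]` are different (criterion at `ℓ₁` with `w = ℓ₂`,
then `[ℓ₁ℓ₂] ≠ [1] ⇒ [ℓ₁] ≠ [ℓ₂]`). [cite: Deligne1982HodgeCycles, §4 p. 30 (1) and Cor. 4.2] -/
theorem prime_eq_of_mk_eq_of_criterion (P : Set ℕ) (hP : ∀ ℓ ∈ P, ℓ.Prime)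
    (hcrit : ∀ ℓ ∈ P, ∀ w : ℤ, ¬ (ℓ : ℤ) ∣ w → ∀ u : (realField R)ˣ,
      (u : realField R) = AdjoinRoot.of (realPolyQ R) (ℓ * w) →
        (QuotientGroup.mk u : cmNormResidueGroup R) ≠ splitDiscriminantClassCM R 2)
    {ℓ₁ ℓ₂ : ℕ} (h₁ : ℓ₁ ∈ P) (h₂ : ℓ₂ ∈ P) (u v : (realField R)ˣ) (hu : (u : realField R) = ℓ₁)
    (hv : (v : realField R) = ℓ₂) (huv : (QuotientGroup.mk u : cmNormResidueGroup R) = QuotientGroup.mk v) :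
    ℓ₁ = ℓ₂ := by
  by_contra hne
  have hndvd : ¬ (ℓ₁ : ℤ) ∣ ℓ₂ := fun h =>
    hne ((Nat.prime_dvd_prime_iff_eq (hP _ h₁) (hP _ h₂)).1 (Int.natCast_dvd_natCast.1 h))
  refine mk_ne_mk_of_mk_mul_ne_split u v (hcrit ℓ₁ h₁ ℓ₂ hndvd (u * v) ?_) huv
  rw [Units.val_mul, hu, hv, map_mul, Int.cast_natCast, map_natCast, map_natCast]

/-- **Infinitely many pairwise distinct non-split classes from an infinite prime family with the criterion.** The
set of classes `[ℓ]`, `ℓ ∈ P`, is infinite, and each is a NON-SPLIT Weil-type component.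
[cite: Deligne1982HodgeCycles, §4 p. 30 (1) and Cor. 4.2] [cite: Landherr1936HermitianForms] -/
theorem infinite_prime_classes_of_criterion (P : Set ℕ) (hPinf : P.Infinite) (hP : ∀ ℓ ∈ P, ℓ.Prime)
    (hcrit : ∀ ℓ ∈ P, ∀ w : ℤ, ¬ (ℓ : ℤ) ∣ w → ∀ u : (realField R)ˣ,
      (u : realField R) = AdjoinRoot.of (realPolyQ R) (ℓ * w) →
        (QuotientGroup.mk u : cmNormResidueGroup R) ≠ splitDiscriminantClassCM R 2) :
    Set.Infinite {δ : cmNormResidueGroup R | δ ≠ splitDiscriminantClassCM R 2 ∧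
      ∃ ℓ ∈ P, ∃ u : (realField R)ˣ, (u : realField R) = ℓ ∧ QuotientGroup.mk u = δ} := by
  classical
  let f : ℕ → cmNormResidueGroup R := fun ℓ =>
    if h : (ℓ : realField R) ≠ 0 then QuotientGroup.mk (Units.mk0 (ℓ : realField R) h) else 1
  have hf : ∀ ℓ ∈ P, ∃ h : (ℓ : realField R) ≠ 0, f ℓ = QuotientGroup.mk (Units.mk0 (ℓ : realField R) h) :=
    fun ℓ hℓ => ⟨natCast_ne_zero_realField ℓ (hP ℓ hℓ).one_lt.le, dif_pos _⟩
  have hone : ∀ ℓ ∈ P, ∀ u : (realField R)ˣ, (u : realField R) = ℓ →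
      (QuotientGroup.mk u : cmNormResidueGroup R) ≠ splitDiscriminantClassCM R 2 := fun ℓ hℓ u hu =>
    hcrit ℓ hℓ 1 (by exact_mod_cast (hP ℓ hℓ).not_dvd_one) u
      (by rw [hu, Int.cast_one, mul_one]; exact (map_natCast (AdjoinRoot.of (realPolyQ R)) ℓ).symm)
  have hinj : Set.InjOn f P := by
    intro ℓ₁ h₁ ℓ₂ h₂ he
    obtain ⟨n₁, e₁⟩ := hf ℓ₁ h₁
    obtain ⟨n₂, e₂⟩ := hf ℓ₂ h₂
    rw [e₁, e₂] at he
    exact prime_eq_of_mk_eq_of_criterion P hP hcrit h₁ h₂ _ _ (Units.val_mk0 _) (Units.val_mk0 _) he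
  have hmaps : Set.MapsTo f P {δ : cmNormResidueGroup R | δ ≠ splitDiscriminantClassCM R 2 ∧
      ∃ ℓ ∈ P, ∃ u : (realField R)ˣ, (u : realField R) = ℓ ∧ QuotientGroup.mk u = δ} := by
    intro ℓ hℓ
    obtain ⟨n, e⟩ := hf ℓ hℓ
    rw [Set.mem_setOf_eq, e]
    exact ⟨hone ℓ hℓ _ (Units.val_mk0 _), ℓ, hℓ, Units.mk0 _ n, Units.val_mk0 _, rfl⟩
  exact Set.infinite_of_injOn_mapsTo hinj hmaps hPinf

/-- Corollary shape: infinitely many NON-SPLIT classes in `F^×/Nm_{E/F}(E^×)` (hence infinitely many Weil-type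
components `W8.E.δ` without an `E`-Lagrangian member, Deligne Cor. 4.2), and the index group is infinite.
[cite: Deligne1982HodgeCycles, §4 p. 30 (1) and Cor. 4.2] -/
theorem infinite_nonsplit_of_criterion (P : Set ℕ) (hPinf : P.Infinite) (hP : ∀ ℓ ∈ P, ℓ.Prime)
    (hcrit : ∀ ℓ ∈ P, ∀ w : ℤ, ¬ (ℓ : ℤ) ∣ w → ∀ u : (realField R)ˣ,
      (u : realField R) = AdjoinRoot.of (realPolyQ R) (ℓ * w) →
        (QuotientGroup.mk u : cmNormResidueGroup R) ≠ splitDiscriminantClassCM R 2) :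
    Set.Infinite {δ : cmNormResidueGroup R | δ ≠ splitDiscriminantClassCM R 2} ∧ Infinite (cmNormResidueGroup R) := by
  have h := (infinite_prime_classes_of_criterion P hPinf hP hcrit).mono (fun δ hδ => hδ.1)
  exact ⟨h, Set.infinite_univ_iff.1 (h.mono (Set.subset_univ _))⟩

/-- Dirichlet (Mathlib), in the `%` form used by parts A–C: infinitely many primes `ℓ` with `ℓ % q = a` for
`a < q` coprime to `q`. [folklore] -/
theorem infinite_setOf_prime_and_mod_eq {q a : ℕ} (hq : q ≠ 0) (ha : a < q) (h : a.Coprime q) :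
    Set.Infinite {ℓ : ℕ | ℓ.Prime ∧ ℓ % q = a} := by
  have := Nat.infinite_setOf_prime_and_modEq hq h
  refine this.mono ?_
  rintro ℓ ⟨hℓ, hmod⟩
  exact ⟨hℓ, by rw [Nat.ModEq] at hmod; rw [hmod, Nat.mod_eq_of_lt ha]⟩

end Generic

/-! ### §1–§7 The seven census fields -/

section Fields

/-- **`ℚ(ζ₅)`: the classes `[ℓ]`, `ℓ` prime, `ℓ ≢ 0, 1 (mod 5)`, `ℓ ≠ 2`, are PAIRWISE DISTINCT non-split components;
there are INFINITELY MANY non-split Weil-type components `W8.E.δ` for `E = ℚ(ζ₅)`, and `F^×/Nm_{E/F}(E^×)` is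
infinite.** [cite: Deligne1982HodgeCycles, §4 p. 30 (1) and Cor. 4.2] [cite: Landherr1936HermitianForms] -/
theorem zeta5_infinite_nonsplit {R : Polynomial ℤ} (hR : R = X ^ 2 + C 5 * X + C 5)
    [Fact (Irreducible (realPolyQ R))] :
    Set.Infinite {δ : cmNormResidueGroup R | δ ≠ splitDiscriminantClassCM R 2 ∧
      ∃ ℓ ∈ {ℓ : ℕ | ℓ.Prime ∧ ℓ ≠ 2 ∧ (ℓ % 5 = 2 ∨ ℓ % 5 = 3 ∨ ℓ % 5 = 4)},
        ∃ u : (realField R)ˣ, (u : realField R) = ℓ ∧ QuotientGroup.mk u = δ} ∧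
    Set.Infinite {δ : cmNormResidueGroup R | δ ≠ splitDiscriminantClassCM R 2} ∧ Infinite (cmNormResidueGroup R) := by
  haveI := fact_irreducible_cmPolyQ_of_pos hR (by norm_num) (by norm_num) disc_not_sq_five_five
  have hPinf : Set.Infinite {ℓ : ℕ | ℓ.Prime ∧ ℓ ≠ 2 ∧ (ℓ % 5 = 2 ∨ ℓ % 5 = 3 ∨ ℓ % 5 = 4)} :=
    (infinite_setOf_prime_and_mod_eq (q := 5) (a := 4) (by norm_num) (by norm_num) (by norm_num)).mono
      (by rintro ℓ ⟨hℓ, h⟩; exact ⟨hℓ, by omega, Or.inr (Or.inr h)⟩)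
  have hP : ∀ ℓ ∈ {ℓ : ℕ | ℓ.Prime ∧ ℓ ≠ 2 ∧ (ℓ % 5 = 2 ∨ ℓ % 5 = 3 ∨ ℓ % 5 = 4)}, ℓ.Prime := fun ℓ h => h.1
  have hcrit := fun ℓ (h : ℓ ∈ {ℓ : ℕ | ℓ.Prime ∧ ℓ ≠ 2 ∧ (ℓ % 5 = 2 ∨ ℓ % 5 = 3 ∨ ℓ % 5 = 4)}) =>
    zeta5_mk_prime_mul_ne_splitDiscriminantClassCM_of_mod_five hR ℓ h.1 h.2.1 h.2.2
  exact ⟨infinite_prime_classes_of_criterion _ hPinf hP hcrit, infinite_nonsplit_of_criterion _ hPinf hP hcrit⟩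

/-- **`ℚ(ζ₅)`: `[ℓ₁] = [ℓ₂] ↔ ℓ₁ = ℓ₂`** for primes `ℓᵢ ≢ 0, 1 (mod 5)`, `ℓᵢ ≠ 2`.
[cite: Deligne1982HodgeCycles, §4 p. 30 (1) and Cor. 4.2] -/
theorem zeta5_mk_prime_eq_mk_prime_iff {R : Polynomial ℤ} (hR : R = X ^ 2 + C 5 * X + C 5)
    [Fact (Irreducible (realPolyQ R))] {ℓ₁ ℓ₂ : ℕ} (h₁ : ℓ₁.Prime) (h₁' : ℓ₁ ≠ 2)
    (h₁'' : ℓ₁ % 5 = 2 ∨ ℓ₁ % 5 = 3 ∨ ℓ₁ % 5 = 4) (h₂ : ℓ₂.Prime) (h₂' : ℓ₂ ≠ 2)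
    (h₂'' : ℓ₂ % 5 = 2 ∨ ℓ₂ % 5 = 3 ∨ ℓ₂ % 5 = 4) (u v : (realField R)ˣ) (hu : (u : realField R) = ℓ₁)
    (hv : (v : realField R) = ℓ₂) :
    (QuotientGroup.mk u : cmNormResidueGroup R) = QuotientGroup.mk v ↔ ℓ₁ = ℓ₂ := by
  haveI := fact_irreducible_cmPolyQ_of_pos hR (by norm_num) (by norm_num) disc_not_sq_five_five
  refine ⟨fun huv => prime_eq_of_mk_eq_of_criterion
    {ℓ : ℕ | ℓ.Prime ∧ ℓ ≠ 2 ∧ (ℓ % 5 = 2 ∨ ℓ % 5 = 3 ∨ ℓ % 5 = 4)} (fun ℓ h => h.1)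
    (fun ℓ h => zeta5_mk_prime_mul_ne_splitDiscriminantClassCM_of_mod_five hR ℓ h.1 h.2.1 h.2.2)
    ⟨h₁, h₁', h₁''⟩ ⟨h₂, h₂', h₂''⟩ u v hu hv huv, ?_⟩
  rintro rfl
  rw [show u = v from Units.ext (hu.trans hv.symm)]

/-- **`ℚ(ζ₈)`: infinitely many pairwise distinct non-split components `W8.E.[ℓ]`, `ℓ ≡ 7 (mod 8)` prime; the set of
non-split classes and the group `F^×/Nm_{E/F}(E^×)` are infinite.** [cite: Deligne1982HodgeCycles, §4 p. 30 (1) and Cor. 4.2]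
[cite: Landherr1936HermitianForms] -/
theorem zeta8_infinite_nonsplit {R : Polynomial ℤ} (hR : R = X ^ 2 + C 6 * X + C 1)
    [Fact (Irreducible (realPolyQ R))] :
    Set.Infinite {δ : cmNormResidueGroup R | δ ≠ splitDiscriminantClassCM R 2 ∧
      ∃ ℓ ∈ {ℓ : ℕ | ℓ.Prime ∧ ℓ % 8 = 7}, ∃ u : (realField R)ˣ, (u : realField R) = ℓ ∧ QuotientGroup.mk u = δ} ∧
    Set.Infinite {δ : cmNormResidueGroup R | δ ≠ splitDiscriminantClassCM R 2} ∧ Infinite (cmNormResidueGroup R) := by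
  haveI := fact_irreducible_cmPolyQ_of_pos hR (by norm_num) (by norm_num) disc_not_sq_six_one
  have hPinf : Set.Infinite {ℓ : ℕ | ℓ.Prime ∧ ℓ % 8 = 7} :=
    infinite_setOf_prime_and_mod_eq (by norm_num) (by norm_num) (by norm_num)
  have hP : ∀ ℓ ∈ {ℓ : ℕ | ℓ.Prime ∧ ℓ % 8 = 7}, ℓ.Prime := fun ℓ h => h.1
  have hcrit := fun ℓ (h : ℓ ∈ {ℓ : ℕ | ℓ.Prime ∧ ℓ % 8 = 7}) =>
    zeta8_mk_prime_mul_ne_splitDiscriminantClassCM_of_mod_eight hR ℓ h.1 h.2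
  exact ⟨infinite_prime_classes_of_criterion _ hPinf hP hcrit, infinite_nonsplit_of_criterion _ hPinf hP hcrit⟩

/-- **`ℚ(ζ₈)`: `[ℓ₁] = [ℓ₂] ↔ ℓ₁ = ℓ₂`** for primes `ℓᵢ ≡ 7 (mod 8)`. [cite: Deligne1982HodgeCycles, §4 p. 30 (1) and Cor. 4.2] -/
theorem zeta8_mk_prime_eq_mk_prime_iff {R : Polynomial ℤ} (hR : R = X ^ 2 + C 6 * X + C 1)
    [Fact (Irreducible (realPolyQ R))] {ℓ₁ ℓ₂ : ℕ} (h₁ : ℓ₁.Prime) (h₁' : ℓ₁ % 8 = 7) (h₂ : ℓ₂.Prime)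
    (h₂' : ℓ₂ % 8 = 7) (u v : (realField R)ˣ) (hu : (u : realField R) = ℓ₁) (hv : (v : realField R) = ℓ₂) :
    (QuotientGroup.mk u : cmNormResidueGroup R) = QuotientGroup.mk v ↔ ℓ₁ = ℓ₂ := by
  haveI := fact_irreducible_cmPolyQ_of_pos hR (by norm_num) (by norm_num) disc_not_sq_six_one
  refine ⟨fun huv => prime_eq_of_mk_eq_of_criterion {ℓ : ℕ | ℓ.Prime ∧ ℓ % 8 = 7} (fun ℓ h => h.1)
    (fun ℓ h => zeta8_mk_prime_mul_ne_splitDiscriminantClassCM_of_mod_eight hR ℓ h.1 h.2)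
    ⟨h₁, h₁'⟩ ⟨h₂, h₂'⟩ u v hu hv huv, ?_⟩
  rintro rfl
  rw [show u = v from Units.ext (hu.trans hv.symm)]

/-- **`ℚ(ζ₁₂)`: infinitely many pairwise distinct non-split components `W8.E.[ℓ]`, `ℓ ≡ 11 (mod 12)` prime; the
non-split classes and `F^×/Nm_{E/F}(E^×)` are infinite.** [cite: Deligne1982HodgeCycles, §4 p. 30 (1) and Cor. 4.2]
[cite: Landherr1936HermitianForms] -/
theorem zeta12_infinite_nonsplit {R : Polynomial ℤ} (hR : R = X ^ 2 + C 8 * X + C 4)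
    [Fact (Irreducible (realPolyQ R))] :
    Set.Infinite {δ : cmNormResidueGroup R | δ ≠ splitDiscriminantClassCM R 2 ∧
      ∃ ℓ ∈ {ℓ : ℕ | ℓ.Prime ∧ ℓ % 12 = 11}, ∃ u : (realField R)ˣ, (u : realField R) = ℓ ∧ QuotientGroup.mk u = δ} ∧
    Set.Infinite {δ : cmNormResidueGroup R | δ ≠ splitDiscriminantClassCM R 2} ∧ Infinite (cmNormResidueGroup R) := by
  haveI := fact_irreducible_cmPolyQ_of_pos hR (by norm_num) (by norm_num) disc_not_sq_eight_four
  have hPinf : Set.Infinite {ℓ : ℕ | ℓ.Prime ∧ ℓ % 12 = 11} :=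
    infinite_setOf_prime_and_mod_eq (by norm_num) (by norm_num) (by norm_num)
  have hP : ∀ ℓ ∈ {ℓ : ℕ | ℓ.Prime ∧ ℓ % 12 = 11}, ℓ.Prime := fun ℓ h => h.1
  have hcrit := fun ℓ (h : ℓ ∈ {ℓ : ℕ | ℓ.Prime ∧ ℓ % 12 = 11}) =>
    zeta12_mk_prime_mul_ne_splitDiscriminantClassCM_of_mod_twelve hR ℓ h.1 h.2
  exact ⟨infinite_prime_classes_of_criterion _ hPinf hP hcrit, infinite_nonsplit_of_criterion _ hPinf hP hcrit⟩

/-- **`ℚ(√-3,√5)`: infinitely many pairwise distinct non-split components `W8.E.[ℓ]`, `ℓ ≡ 11, 14 (mod 15)` prime; the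
non-split classes and `F^×/Nm_{E/F}(E^×)` are infinite.** [cite: Deligne1982HodgeCycles, §4 p. 30 (1) and Cor. 4.2]
[cite: Landherr1936HermitianForms] -/
theorem sqrtNeg3Sqrt5_infinite_nonsplit {R : Polynomial ℤ} (hR : R = X ^ 2 + C 9 * X + C 9)
    [Fact (Irreducible (realPolyQ R))] :
    Set.Infinite {δ : cmNormResidueGroup R | δ ≠ splitDiscriminantClassCM R 2 ∧
      ∃ ℓ ∈ {ℓ : ℕ | ℓ.Prime ∧ (ℓ % 5 = 1 ∨ ℓ % 5 = 4) ∧ ℓ % 3 = 2},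
        ∃ u : (realField R)ˣ, (u : realField R) = ℓ ∧ QuotientGroup.mk u = δ} ∧
    Set.Infinite {δ : cmNormResidueGroup R | δ ≠ splitDiscriminantClassCM R 2} ∧ Infinite (cmNormResidueGroup R) := by
  haveI := fact_irreducible_cmPolyQ_of_pos hR (by norm_num) (by norm_num) disc_not_sq_nine_nine
  have hPinf : Set.Infinite {ℓ : ℕ | ℓ.Prime ∧ (ℓ % 5 = 1 ∨ ℓ % 5 = 4) ∧ ℓ % 3 = 2} :=
    (infinite_setOf_prime_and_mod_eq (q := 15) (a := 14) (by norm_num) (by norm_num) (by norm_num)).mono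
      (by rintro ℓ ⟨hℓ, h⟩; exact ⟨hℓ, by omega, by omega⟩)
  have hP : ∀ ℓ ∈ {ℓ : ℕ | ℓ.Prime ∧ (ℓ % 5 = 1 ∨ ℓ % 5 = 4) ∧ ℓ % 3 = 2}, ℓ.Prime := fun ℓ h => h.1
  have hcrit := fun ℓ (h : ℓ ∈ {ℓ : ℕ | ℓ.Prime ∧ (ℓ % 5 = 1 ∨ ℓ % 5 = 4) ∧ ℓ % 3 = 2}) =>
    sqrtNeg3Sqrt5_mk_prime_mul_ne_splitDiscriminantClassCM_of_mod hR ℓ h.1 h.2.1 h.2.2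
  exact ⟨infinite_prime_classes_of_criterion _ hPinf hP hcrit, infinite_nonsplit_of_criterion _ hPinf hP hcrit⟩

/-- **`ℚ(i,√5)`: infinitely many pairwise distinct non-split components `W8.E.[ℓ]`, `ℓ ≡ 11, 19 (mod 20)` prime; the
non-split classes and `F^×/Nm_{E/F}(E^×)` are infinite.** [cite: Deligne1982HodgeCycles, §4 p. 30 (1) and Cor. 4.2]
[cite: Landherr1936HermitianForms] -/
theorem sqrtNeg1Sqrt5_infinite_nonsplit {R : Polynomial ℤ} (hR : R = X ^ 2 + C 3 * X + C 1)
    [Fact (Irreducible (realPolyQ R))] :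
    Set.Infinite {δ : cmNormResidueGroup R | δ ≠ splitDiscriminantClassCM R 2 ∧
      ∃ ℓ ∈ {ℓ : ℕ | ℓ.Prime ∧ (ℓ % 5 = 1 ∨ ℓ % 5 = 4) ∧ ℓ % 4 = 3},
        ∃ u : (realField R)ˣ, (u : realField R) = ℓ ∧ QuotientGroup.mk u = δ} ∧
    Set.Infinite {δ : cmNormResidueGroup R | δ ≠ splitDiscriminantClassCM R 2} ∧ Infinite (cmNormResidueGroup R) := by
  haveI := fact_irreducible_cmPolyQ_of_pos hR (by norm_num) (by norm_num) disc_not_sq_three_one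
  have hPinf : Set.Infinite {ℓ : ℕ | ℓ.Prime ∧ (ℓ % 5 = 1 ∨ ℓ % 5 = 4) ∧ ℓ % 4 = 3} :=
    (infinite_setOf_prime_and_mod_eq (q := 20) (a := 19) (by norm_num) (by norm_num) (by norm_num)).mono
      (by rintro ℓ ⟨hℓ, h⟩; exact ⟨hℓ, by omega, by omega⟩)
  have hP : ∀ ℓ ∈ {ℓ : ℕ | ℓ.Prime ∧ (ℓ % 5 = 1 ∨ ℓ % 5 = 4) ∧ ℓ % 4 = 3}, ℓ.Prime := fun ℓ h => h.1
  have hcrit := fun ℓ (h : ℓ ∈ {ℓ : ℕ | ℓ.Prime ∧ (ℓ % 5 = 1 ∨ ℓ % 5 = 4) ∧ ℓ % 4 = 3}) =>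
    sqrtNeg1Sqrt5_mk_prime_mul_ne_splitDiscriminantClassCM_of_mod hR ℓ h.1 h.2.1 h.2.2
  exact ⟨infinite_prime_classes_of_criterion _ hPinf hP hcrit, infinite_nonsplit_of_criterion _ hPinf hP hcrit⟩

/-- **`ℚ(√-(2+√2))`: infinitely many pairwise distinct non-split components `W8.E.[ℓ]`, `ℓ ≢ ±1 (mod 16)` prime,
`ℓ ≠ 2` (parts C and G: all primes not totally split in `E`); the non-split classes and `F^×/Nm_{E/F}(E^×)` are
infinite.** [cite: Deligne1982HodgeCycles, §4 p. 30 (1) and Cor. 4.2] [cite: Landherr1936HermitianForms] -/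
theorem sqrtNegTwoPlusSqrtTwo_infinite_nonsplit {R : Polynomial ℤ} (hR : R = X ^ 2 + C 4 * X + C 2)
    [Fact (Irreducible (realPolyQ R))] :
    Set.Infinite {δ : cmNormResidueGroup R | δ ≠ splitDiscriminantClassCM R 2 ∧
      ∃ ℓ ∈ {ℓ : ℕ | ℓ.Prime ∧ ℓ ≠ 2 ∧ ℓ % 16 ≠ 1 ∧ ℓ % 16 ≠ 7},
        ∃ u : (realField R)ˣ, (u : realField R) = ℓ ∧ QuotientGroup.mk u = δ} ∧
    Set.Infinite {δ : cmNormResidueGroup R | δ ≠ splitDiscriminantClassCM R 2} ∧ Infinite (cmNormResidueGroup R) := by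
  haveI := fact_irreducible_cmPolyQ_of_pos hR (by norm_num) (by norm_num) disc_not_sq_four_two
  have hPinf : Set.Infinite {ℓ : ℕ | ℓ.Prime ∧ ℓ ≠ 2 ∧ ℓ % 16 ≠ 1 ∧ ℓ % 16 ≠ 7} :=
    (infinite_setOf_prime_and_mod_eq (q := 8) (a := 3) (by norm_num) (by norm_num) (by norm_num)).mono
      (by rintro ℓ ⟨hℓ, h⟩; exact ⟨hℓ, by omega, by omega, by omega⟩)
  have hP : ∀ ℓ ∈ {ℓ : ℕ | ℓ.Prime ∧ ℓ ≠ 2 ∧ ℓ % 16 ≠ 1 ∧ ℓ % 16 ≠ 7}, ℓ.Prime := fun ℓ h => h.1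
  have hcrit := fun ℓ (h : ℓ ∈ {ℓ : ℕ | ℓ.Prime ∧ ℓ ≠ 2 ∧ ℓ % 16 ≠ 1 ∧ ℓ % 16 ≠ 7}) =>
    sqrtNegTwoPlusSqrtTwo_mk_prime_mul_ne_splitDiscriminantClassCM_of_mod_sixteen_ne hR ℓ h.1 h.2.1 h.2.2.1 h.2.2.2
  exact ⟨infinite_prime_classes_of_criterion _ hPinf hP hcrit, infinite_nonsplit_of_criterion _ hPinf hP hcrit⟩

/-- **`ℚ(√-(2+√2))`: `[ℓ₁] = [ℓ₂] ↔ ℓ₁ = ℓ₂`** for primes `ℓᵢ ≢ ±1 (mod 16)`, `ℓᵢ ≠ 2`.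
[cite: Deligne1982HodgeCycles, §4 p. 30 (1) and Cor. 4.2] -/
theorem sqrtNegTwoPlusSqrtTwo_mk_prime_eq_mk_prime_iff {R : Polynomial ℤ} (hR : R = X ^ 2 + C 4 * X + C 2)
    [Fact (Irreducible (realPolyQ R))] {ℓ₁ ℓ₂ : ℕ} (h₁ : ℓ₁.Prime) (h₁₂ : ℓ₁ ≠ 2) (h₁₁ : ℓ₁ % 16 ≠ 1)
    (h₁₇ : ℓ₁ % 16 ≠ 7) (h₂ : ℓ₂.Prime) (h₂₂ : ℓ₂ ≠ 2) (h₂₁ : ℓ₂ % 16 ≠ 1) (h₂₇ : ℓ₂ % 16 ≠ 7)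
    (u v : (realField R)ˣ) (hu : (u : realField R) = ℓ₁) (hv : (v : realField R) = ℓ₂) :
    (QuotientGroup.mk u : cmNormResidueGroup R) = QuotientGroup.mk v ↔ ℓ₁ = ℓ₂ := by
  haveI := fact_irreducible_cmPolyQ_of_pos hR (by norm_num) (by norm_num) disc_not_sq_four_two
  refine ⟨fun huv => prime_eq_of_mk_eq_of_criterion {ℓ : ℕ | ℓ.Prime ∧ ℓ ≠ 2 ∧ ℓ % 16 ≠ 1 ∧ ℓ % 16 ≠ 7}
    (fun ℓ h => h.1)
    (fun ℓ h => sqrtNegTwoPlusSqrtTwo_mk_prime_mul_ne_splitDiscriminantClassCM_of_mod_sixteen_ne hR ℓ h.1 h.2.1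
      h.2.2.1 h.2.2.2)
    ⟨h₁, h₁₂, h₁₁, h₁₇⟩ ⟨h₂, h₂₂, h₂₁, h₂₇⟩ u v hu hv huv, ?_⟩
  rintro rfl
  rw [show u = v from Units.ext (hu.trans hv.symm)]

/-- **`ℚ(√-(3+√2))` (non-Galois, `D₄`): infinitely many pairwise distinct non-split components `W8.E.[ℓ]`,
`ℓ mod 56 ∈ {5, 11, 13, 43, 45, 51}` prime; the non-split classes and `F^×/Nm_{E/F}(E^×)` are infinite.**
[cite: Deligne1982HodgeCycles, §4 p. 30 (1) and Cor. 4.2] [cite: Landherr1936HermitianForms] -/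
theorem sqrtNegThreePlusSqrtTwo_infinite_nonsplit {R : Polynomial ℤ} (hR : R = X ^ 2 + C 6 * X + C 7)
    [Fact (Irreducible (realPolyQ R))] :
    Set.Infinite {δ : cmNormResidueGroup R | δ ≠ splitDiscriminantClassCM R 2 ∧
      ∃ ℓ ∈ {ℓ : ℕ | ℓ.Prime ∧
        (ℓ % 56 = 5 ∨ ℓ % 56 = 11 ∨ ℓ % 56 = 13 ∨ ℓ % 56 = 43 ∨ ℓ % 56 = 45 ∨ ℓ % 56 = 51)},
        ∃ u : (realField R)ˣ, (u : realField R) = ℓ ∧ QuotientGroup.mk u = δ} ∧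
    Set.Infinite {δ : cmNormResidueGroup R | δ ≠ splitDiscriminantClassCM R 2} ∧ Infinite (cmNormResidueGroup R) := by
  haveI := fact_irreducible_cmPolyQ_of_pos hR (by norm_num) (by norm_num) disc_not_sq_six_seven
  have hPinf : Set.Infinite {ℓ : ℕ | ℓ.Prime ∧
      (ℓ % 56 = 5 ∨ ℓ % 56 = 11 ∨ ℓ % 56 = 13 ∨ ℓ % 56 = 43 ∨ ℓ % 56 = 45 ∨ ℓ % 56 = 51)} :=
    (infinite_setOf_prime_and_mod_eq (q := 56) (a := 5) (by norm_num) (by norm_num) (by norm_num)).mono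
      (by rintro ℓ ⟨hℓ, h⟩; exact ⟨hℓ, Or.inl h⟩)
  have hP : ∀ ℓ ∈ {ℓ : ℕ | ℓ.Prime ∧
      (ℓ % 56 = 5 ∨ ℓ % 56 = 11 ∨ ℓ % 56 = 13 ∨ ℓ % 56 = 43 ∨ ℓ % 56 = 45 ∨ ℓ % 56 = 51)}, ℓ.Prime :=
    fun ℓ h => h.1
  have hcrit := fun ℓ (h : ℓ ∈ {ℓ : ℕ | ℓ.Prime ∧
      (ℓ % 56 = 5 ∨ ℓ % 56 = 11 ∨ ℓ % 56 = 13 ∨ ℓ % 56 = 43 ∨ ℓ % 56 = 45 ∨ ℓ % 56 = 51)}) =>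
    sqrtNegThreePlusSqrtTwo_mk_prime_mul_ne_splitDiscriminantClassCM_of_mod_fiftySix hR ℓ h.1 h.2
  exact ⟨infinite_prime_classes_of_criterion _ hPinf hP hcrit, infinite_nonsplit_of_criterion _ hPinf hP hcrit⟩

end Fields

/-! ### §8 Unconditional packagings (`R` literal): the seven index sets are infinite -/

/-- **For each of the seven census fields, `F^×/Nm_{E/F}(E^×)` contains infinitely many NON-SPLIT classes** — with
Deligne's `R` LITERAL and the field `Fact`s discharged (factor exclusion): `ℚ(ζ₅)`, `ℚ(ζ₈)`, `ℚ(ζ₁₂)`, `ℚ(√-3,√5)`,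
`ℚ(i,√5)`, `ℚ(√-(2+√2))`, `ℚ(√-(3+√2))`, i.e. infinitely many Weil-type components `W8.E.δ` of abelian eightfolds
without an `E`-Lagrangian member, for every `E` of the census. [cite: Deligne1982HodgeCycles, §4 p. 30 (1) and Cor. 4.2]
[cite: Landherr1936HermitianForms] -/
theorem census_fields_infinite_nonsplit :
    (haveI := fact_irreducible_realPolyQ_of_not_sq (R := X ^ 2 + C 5 * X + C 5) rfl disc_not_sq_five_five
     Set.Infinite {δ : cmNormResidueGroup (X ^ 2 + C 5 * X + C 5) |
       δ ≠ splitDiscriminantClassCM (X ^ 2 + C 5 * X + C 5) 2}) ∧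
    (haveI := fact_irreducible_realPolyQ_of_not_sq (R := X ^ 2 + C 6 * X + C 1) rfl disc_not_sq_six_one
     Set.Infinite {δ : cmNormResidueGroup (X ^ 2 + C 6 * X + C 1) |
       δ ≠ splitDiscriminantClassCM (X ^ 2 + C 6 * X + C 1) 2}) ∧
    (haveI := fact_irreducible_realPolyQ_of_not_sq (R := X ^ 2 + C 8 * X + C 4) rfl disc_not_sq_eight_four
     Set.Infinite {δ : cmNormResidueGroup (X ^ 2 + C 8 * X + C 4) |
       δ ≠ splitDiscriminantClassCM (X ^ 2 + C 8 * X + C 4) 2}) ∧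
    (haveI := fact_irreducible_realPolyQ_of_not_sq (R := X ^ 2 + C 9 * X + C 9) rfl disc_not_sq_nine_nine
     Set.Infinite {δ : cmNormResidueGroup (X ^ 2 + C 9 * X + C 9) |
       δ ≠ splitDiscriminantClassCM (X ^ 2 + C 9 * X + C 9) 2}) ∧
    (haveI := fact_irreducible_realPolyQ_of_not_sq (R := X ^ 2 + C 3 * X + C 1) rfl disc_not_sq_three_one
     Set.Infinite {δ : cmNormResidueGroup (X ^ 2 + C 3 * X + C 1) |
       δ ≠ splitDiscriminantClassCM (X ^ 2 + C 3 * X + C 1) 2}) ∧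
    (haveI := fact_irreducible_realPolyQ_of_not_sq (R := X ^ 2 + C 4 * X + C 2) rfl disc_not_sq_four_two
     Set.Infinite {δ : cmNormResidueGroup (X ^ 2 + C 4 * X + C 2) |
       δ ≠ splitDiscriminantClassCM (X ^ 2 + C 4 * X + C 2) 2}) ∧
    (haveI := fact_irreducible_realPolyQ_of_not_sq (R := X ^ 2 + C 6 * X + C 7) rfl disc_not_sq_six_seven
     Set.Infinite {δ : cmNormResidueGroup (X ^ 2 + C 6 * X + C 7) |
       δ ≠ splitDiscriminantClassCM (X ^ 2 + C 6 * X + C 7) 2}) := by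
  refine ⟨?_, ?_, ?_, ?_, ?_, ?_, ?_⟩
  · haveI := fact_irreducible_realPolyQ_of_not_sq (R := X ^ 2 + C 5 * X + C 5) rfl disc_not_sq_five_five
    exact (zeta5_infinite_nonsplit rfl).2.1
  · haveI := fact_irreducible_realPolyQ_of_not_sq (R := X ^ 2 + C 6 * X + C 1) rfl disc_not_sq_six_one
    exact (zeta8_infinite_nonsplit rfl).2.1
  · haveI := fact_irreducible_realPolyQ_of_not_sq (R := X ^ 2 + C 8 * X + C 4) rfl disc_not_sq_eight_four
    exact (zeta12_infinite_nonsplit rfl).2.1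
  · haveI := fact_irreducible_realPolyQ_of_not_sq (R := X ^ 2 + C 9 * X + C 9) rfl disc_not_sq_nine_nine
    exact (sqrtNeg3Sqrt5_infinite_nonsplit rfl).2.1
  · haveI := fact_irreducible_realPolyQ_of_not_sq (R := X ^ 2 + C 3 * X + C 1) rfl disc_not_sq_three_one
    exact (sqrtNeg1Sqrt5_infinite_nonsplit rfl).2.1
  · haveI := fact_irreducible_realPolyQ_of_not_sq (R := X ^ 2 + C 4 * X + C 2) rfl disc_not_sq_four_two
    exact (sqrtNegTwoPlusSqrtTwo_infinite_nonsplit rfl).2.1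
  · haveI := fact_irreducible_realPolyQ_of_not_sq (R := X ^ 2 + C 6 * X + C 7) rfl disc_not_sq_six_seven
    exact (sqrtNegThreePlusSqrtTwo_infinite_nonsplit rfl).2.1

end Summit.HodgeConjecture.HodgeConjecture.Ring2.WeilCoverageCM

end
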